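import Summits.ValiantsHypothesis.ValiantsHypothesis.Theorems.LacunarySymmetroidMatrixDescartesDoorA26WallBubblingTwoSlopeLinking

/-!
# Wall bubbling for `DoorA26` — (W-split)/(R) LINKING LAW, first NAMED KILL: no two-cluster tight chain hinges strictly between two letters

HONEST FRAMING.  Helper theorems for the line `Cruxes/DoorA26/Lines/wall_bubbling.lean` (crux stmt-ValiantsHypothesis-19979 `DoorA26`; OPEN, typed,
never asserted), W2 seat val-sym-door-p1 g16, on top of W2 #34 `…WallBubblingTwoSlopeLinking` (the two-slope top-class law).  Def-free; the order-reversing matching is the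
explicit permutation `Fin.revPerm` (no definition introduced); nothing here bears on `DoorA26`,
`MatrixDescartes` (stmt-ValiantsHypothesis-18050) or `VP ≠ VNP`; registers unchanged.

THE KILL (`false_of_hinge_strictly_between`, package currency `false_of_hinge_strictly_between_of_packages`).  Take four letters with limiting exponents
`δa < δb < δc < δd` and suppose two consecutive clusters of a tight chain hinge at the member `(b,c)` (value `v = δb + δc`).  In the principal `4 × 4` minor
on these letters every member has a definite side: `aa, ab, ac, bb` below, `cc, bd, cd, dd` above, `bc = v`, and `ad` on either side (generic).  The sum of
the four signed distances of any matching is `2(δa + δd − v)` (`hinge_gap_pos`: `Σ|u| ≥ |Σu|`, triangle inequality), with equality iff all four values lie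
weakly on one side — and the sign table forces such a matching to be the ORDER-REVERSING one `{ad, ad, bc, bc}` (`Fin.revPerm`).  So the order-reversing matching is
the unique ℓ¹-closest monomial, its `γ`-product is `γ_ad² γ_bc² ≠ 0` (both members alive), and `false_of_topClass_singleton` (#34) is contradicted.  At generic
support (all members alive, #28) this excludes EVERY hinge `δ_p + δ_q` with `0 < p < q < 5` (letters `0` and `5` flank it): exactly the located census's
15 648/15 648 (kit j321716), leaving as middle hinges only `δ₀ + δ_q`, `δ_p + δ₅` and the diagonal values `2δ_p`.  At a generic Weyl face the same applies to
frame letters avoiding the merged letter (transvection-free minors), e.g. hinge `x_p + x_q` flanked by `α` below (T-direction letter) and a plain letter above.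
LONGER CHAINS: the same applies to every CONSECUTIVE pair of clusters `(c, c+1)` of a tight chain with `C ≥ 3` clusters — members whose value lies outside
`Λ_c ∪ Λ_{c+1}` are dead in both packages (`Γ_c = Γ_{c+1} = 0` there, which is all the dictionary needs) and only make the competing monomials smaller; the
kill needs `ad` alive in one of the two clusters, i.e. `min Λ_c ≤ δa + δd ≤ max Λ_{c+1}`.  Located (this seat): by this rule ALONE 238 844 of the 445 968
three-cluster profiles at generic support die (81 924 of the 117 360 with all clusters ≥ 4 zeros); the full 4×4 law kills 377 562 (kit j321781).

[folklore] triangle inequality with equality case; [this work] the hinge exclusion.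
-/

-- `Summit.ValiantsHypothesis.ValiantsHypothesis.…` repeats a component by the D-0017 layout
-- (single-conjunct summit), which the `dupNamespace` linter flags; the name is mandated.
set_option linter.dupNamespace false

namespace Summit.ValiantsHypothesis.ValiantsHypothesis.Theorems.LacunarySymmetroidMatrixDescartes.WallBubbling

open Finset Filter Topology
open scoped BigOperators

/-! ## §5 FIRST NAMED LINKING KILL: a two-cluster tight chain cannot hinge at an INTERIOR OFF-DIAGONAL value -/

/-- Opposite strict signs make the triangle inequality strict: `a < 0 < b ⇒ |a + b| < |a| + |b|`. [folklore] -/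
theorem abs_add_lt_of_neg_of_pos {a b : ℝ} (ha : a < 0) (hb : 0 < b) : |a + b| < |a| + |b| := by
  rw [abs_of_neg ha, abs_of_pos hb]
  rcases le_or_gt 0 (a + b) with h | h
  · rw [abs_of_nonneg h]; linarith
  · rw [abs_of_neg h]; linarith

/-- On `Fin 4`: two entries of opposite strict signs make `|Σ x| < Σ |x|`. [folklore] -/
theorem abs_sum_lt_sum_abs_fin4 (x : Fin 4 → ℝ) (i j : Fin 4) (hi : x i < 0) (hj : 0 < x j) :
    |∑ k, x k| < ∑ k, |x k| := by
  have hij : i ≠ j := by rintro rfl; exact lt_asymm hi hj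
  classical
  -- split off `i` and `j`
  have hsplit : ∀ f : Fin 4 → ℝ, ∑ k, f k = f i + f j + ∑ k ∈ ((univ.erase i).erase j), f k := by
    intro f
    rw [← Finset.add_sum_erase _ _ (Finset.mem_univ i), ← Finset.add_sum_erase _ _ (Finset.mem_erase.mpr ⟨hij.symm, Finset.mem_univ j⟩)]
    ring
  rw [hsplit x, hsplit (fun k => |x k|)]
  have h1 : |x i + x j + ∑ k ∈ (univ.erase i).erase j, x k| ≤ |x i + x j| + ∑ k ∈ (univ.erase i).erase j, |x k| :=
    (abs_add_le _ _).trans (by gcongr; exact Finset.abs_sum_le_sum_abs _ _)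
  have h2 := abs_add_lt_of_neg_of_pos hi hj
  linarith

/-- The order-reversing permutation `Fin.revPerm` of `Fin 4` (Mathlib; no definition is introduced here): its four values. [folklore] -/
theorem revFour_apply :
    (Fin.revPerm : Equiv.Perm (Fin 4)) 0 = 3 ∧ (Fin.revPerm : Equiv.Perm (Fin 4)) 1 = 2 ∧
    (Fin.revPerm : Equiv.Perm (Fin 4)) 2 = 1 ∧ (Fin.revPerm : Equiv.Perm (Fin 4)) 3 = 0 := by
  decide

/-- **COMBINATORIAL HEART.**  Four exponents `δa < δb < δc < δd`, hinge value `v = δb + δc`,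
letters listed as `e = ![a', b', c', d']` with those exponents.  For every permutation `σ ≠ Fin.revPerm` of the four positions, the ℓ¹-distance of the
monomial's values to the hinge STRICTLY exceeds that of the order-reversing matching `{ad, ad, bc, bc}`:
`Σ_i |δ(e(σ i)) + δ(e i) − v| > 2|δa + δd − v|`.  (Triangle inequality `Σ|u| ≥ |Σu| = 2|u_ad|`, with equality only if all four values lie weakly on one
side of the hinge, which forces `σ` to be the order-reversing matching by the order of the exponents.) [this work] -/
theorem hinge_gap_pos {n : ℕ} (δ : Fin n → ℝ) (e : Fin 4 → Fin n)
    (hab : δ (e 0) < δ (e 1)) (hbc : δ (e 1) < δ (e 2)) (hcd : δ (e 2) < δ (e 3))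
    (σ : Equiv.Perm (Fin 4)) (hσ : σ ≠ (Fin.revPerm : Equiv.Perm (Fin 4))) :
    ∑ i, |δ (e ((Fin.revPerm : Equiv.Perm (Fin 4)) i)) + δ (e i) - (δ (e 1) + δ (e 2))|
      < ∑ i, |δ (e (σ i)) + δ (e i) - (δ (e 1) + δ (e 2))| := by
  classical
  have fin4_cases : ∀ x : Fin 4, x = 0 ∨ x = 1 ∨ x = 2 ∨ x = 3 := by decide
  set v := δ (e 1) + δ (e 2) with hv
  set x : Fin 4 → ℝ := fun i => δ (e (σ i)) + δ (e i) - v with hx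
  -- the reversing matching: values ad, bc(=v), bc, ad
  have hrev : ∑ i, |δ (e ((Fin.revPerm : Equiv.Perm (Fin 4)) i)) + δ (e i) - v| = 2 * |δ (e 0) + δ (e 3) - v| := by
    simp only [Fin.sum_univ_four, revFour_apply.1, revFour_apply.2.1, revFour_apply.2.2.1, revFour_apply.2.2.2]
    have h1 : δ (e 2) + δ (e 1) - v = 0 := by rw [hv]; ring
    have h2 : δ (e 1) + δ (e 2) - v = 0 := by rw [hv]; ring
    rw [h1, h2, abs_zero, show δ (e 3) + δ (e 0) - v = δ (e 0) + δ (e 3) - v by ring]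
    ring
  -- the sum of the x's is 2 u_ad for every σ
  have hσsum : ∑ i, δ (e (σ i)) = ∑ i, δ (e i) := Equiv.sum_comp σ (fun i => δ (e i))
  have hsum : ∑ i, x i = 2 * (δ (e 0) + δ (e 3) - v) := by
    simp only [hx]
    rw [Finset.sum_sub_distrib, Finset.sum_add_distrib, hσsum]
    simp only [Fin.sum_univ_four]
    rw [hv]; ring
  rw [hrev]
  show 2 * |δ (e 0) + δ (e 3) - v| < ∑ i, |x i|
  have htri : 2 * |δ (e 0) + δ (e 3) - v| = |∑ i, x i| := by
    rw [hsum, abs_mul, abs_two]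
  rw [htri]
  -- it suffices to find two entries of opposite strict signs
  by_contra hle
  push Not at hle
  have heq : ¬ ∃ i j, x i < 0 ∧ 0 < x j := by
    rintro ⟨i, j, hi, hj⟩
    exact absurd (abs_sum_lt_sum_abs_fin4 x i j hi hj) (not_lt.mpr hle)
  push Not at heq
  -- so all `x i ≥ 0` or all `x i ≤ 0`
  have hcase : (∀ i, 0 ≤ x i) ∨ (∀ i, x i ≤ 0) := by
    by_cases h : ∃ i, x i < 0
    · obtain ⟨i, hi⟩ := h
      right; intro j; exact heq i j hi
    · push Not at h; left; exact h
  -- sign table of the members (relative to v = δb + δc)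
  have uaa : δ (e 0) + δ (e 0) - v < 0 := by rw [hv]; linarith
  have uba : δ (e 1) + δ (e 0) - v < 0 := by rw [hv]; linarith
  have uca : δ (e 2) + δ (e 0) - v < 0 := by rw [hv]; linarith
  have uab : δ (e 0) + δ (e 1) - v < 0 := by rw [hv]; linarith
  have uac : δ (e 0) + δ (e 2) - v < 0 := by rw [hv]; linarith
  have ubb : δ (e 1) + δ (e 1) - v < 0 := by rw [hv]; linarith
  have ucc : 0 < δ (e 2) + δ (e 2) - v := by rw [hv]; linarith
  have ubd : 0 < δ (e 1) + δ (e 3) - v := by rw [hv]; linarith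
  have ucd : 0 < δ (e 2) + δ (e 3) - v := by rw [hv]; linarith
  have udb : 0 < δ (e 3) + δ (e 1) - v := by rw [hv]; linarith
  have udc : 0 < δ (e 3) + δ (e 2) - v := by rw [hv]; linarith
  have udd : 0 < δ (e 3) + δ (e 3) - v := by rw [hv]; linarith
  have hinj : Function.Injective σ := σ.injective
  apply hσ
  rcases hcase with hpos | hneg
  · -- all values weakly above the hinge
    -- column a (i = 0): the row must be d
    have h0 : σ 0 = 3 := by
      have := hpos 0; simp only [hx] at this
      rcases fin4_cases (σ 0) with h | h | h | h <;> rw [h] at this <;> first | linarith | exact h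
    -- row a sits at the column i₀ with σ i₀ = 0; that column must be d
    have h3 : σ 3 = 0 := by
      obtain ⟨i₀, hi₀⟩ := σ.surjective 0
      have := hpos i₀; simp only [hx, hi₀] at this
      rcases fin4_cases i₀ with h | h | h | h <;> rw [h] at this hi₀ <;> first | linarith | exact hi₀
    have h1 : σ 1 = 2 := by
      have := hpos 1; simp only [hx] at this
      rcases fin4_cases (σ 1) with h | h | h | h
      · exact absurd (h.trans h3.symm) (fun h' => by have := hinj h'; exact absurd this (by decide))
      · rw [h] at this; linarith
      · exact h
      · exact absurd (h.trans h0.symm) (fun h' => by have := hinj h'; exact absurd this (by decide))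
    have h2 : σ 2 = 1 := by
      rcases fin4_cases (σ 2) with h | h | h | h
      · exact absurd (h.trans h3.symm) (fun h' => by have := hinj h'; exact absurd this (by decide))
      · exact h
      · exact absurd (h.trans h1.symm) (fun h' => by have := hinj h'; exact absurd this (by decide))
      · exact absurd (h.trans h0.symm) (fun h' => by have := hinj h'; exact absurd this (by decide))
    ext i
    rcases fin4_cases i with h | h | h | h <;> subst h <;>
      simp [h0, h1, h2, h3, revFour_apply.1, revFour_apply.2.1, revFour_apply.2.2.1, revFour_apply.2.2.2]
  · -- all values weakly below the hinge
    have h3 : σ 3 = 0 := by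
      have := hneg 3; simp only [hx] at this
      rcases fin4_cases (σ 3) with h | h | h | h <;> rw [h] at this <;> first | linarith | exact h
    have h0 : σ 0 = 3 := by
      obtain ⟨i₀, hi₀⟩ := σ.surjective 3
      have := hneg i₀; simp only [hx, hi₀] at this
      rcases fin4_cases i₀ with h | h | h | h <;> rw [h] at this hi₀ <;> first | linarith | exact hi₀
    have h2 : σ 2 = 1 := by
      have := hneg 2; simp only [hx] at this
      rcases fin4_cases (σ 2) with h | h | h | h
      · exact absurd (h.trans h3.symm) (fun h' => by have := hinj h'; exact absurd this (by decide))
      · exact h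
      · rw [h] at this; linarith
      · exact absurd (h.trans h0.symm) (fun h' => by have := hinj h'; exact absurd this (by decide))
    have h1 : σ 1 = 2 := by
      rcases fin4_cases (σ 1) with h | h | h | h
      · exact absurd (h.trans h3.symm) (fun h' => by have := hinj h'; exact absurd this (by decide))
      · exact absurd (h.trans h2.symm) (fun h' => by have := hinj h'; exact absurd this (by decide))
      · exact h
      · exact absurd (h.trans h0.symm) (fun h' => by have := hinj h'; exact absurd this (by decide))
    ext i
    rcases fin4_cases i with h | h | h | h <;> subst h <;>
      simp [h0, h1, h2, h3, revFour_apply.1, revFour_apply.2.1, revFour_apply.2.2.1, revFour_apply.2.2.2]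

/-- **NAMED LINKING KILL — NO TIGHT TWO-CHAIN HINGES STRICTLY BETWEEN TWO LETTERS THAT HAVE LETTERS ON BOTH SIDES.**  Gram sequence `G^ν` whose
principal `4 × 4` minor on four letters `e = (a′,b′,c′,d′)` vanishes for every `ν` (rank `≤ 3`, W1 #21); limiting exponents `δ0 a′ < δ0 b′ < δ0 c′ < δ0 d′`
(the exponents `δ^ν` may move); two-slope entry asymptotics relative to the hinge value `v^ν = δ^ν b′ + δ^ν c′` with divergent rate `Δ^ν` (as delivered by
`twoSlope_dictionary` from the two cluster packages of a tight chain hinged at the member `(b′,c′)`); and the four members `da′, cb′, bc′, ad′` of the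
order-reversing matching alive (`γ ≠ 0`).  Contradiction.  By `hinge_gap_pos` the order-reversing matching is the UNIQUE ℓ¹-closest monomial of that minor,
so `false_of_topClass_singleton` applies.  At generic support (all 21 members alive in a tight chain, #28) this kills EVERY two-cluster tight chain hinged at
a value `δ_p + δ_q` with `0 < p < q < 5` (take `a′ = 0`, `d′ = 5`): the located census's 15 648/15 648 (kit j321716); what survives in the middle are hinges at
`δ₀+δ_q`, `δ_p+δ₅`, `2δ_p` only. [this work] -/
theorem false_of_hinge_strictly_between {n : ℕ} (G : ℕ → Matrix (Fin n) (Fin n) ℝ) (e : Fin 4 → Fin n)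
    (hdet : ∀ ν, ((G ν).submatrix e e).det = 0)
    (δ : ℕ → Fin n → ℝ) (δ0 : Fin n → ℝ) (hδ : ∀ l, Tendsto (fun ν => δ ν l) atTop (𝓝 (δ0 l)))
    (hab : δ0 (e 0) < δ0 (e 1)) (hbc : δ0 (e 1) < δ0 (e 2)) (hcd : δ0 (e 2) < δ0 (e 3))
    (γ : Fin n → Fin n → ℝ) (R C : ℕ → Fin n → ℝ) (Δ : ℕ → ℝ) (hΔ : Tendsto Δ atTop atTop)
    (hG : ∀ p q, Tendsto (fun ν => G ν p q / (R ν p * C ν q) *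
        Real.exp (Δ ν * |δ ν p + δ ν q - (δ ν (e 1) + δ ν (e 2))|)) atTop (𝓝 (γ p q)))
    (hne : γ (e 3) (e 0) * γ (e 2) (e 1) * γ (e 1) (e 2) * γ (e 0) (e 3) ≠ 0) : False := by
  classical
  refine false_of_topClass_singleton G e e hdet γ
    (fun ν p q => |δ ν p + δ ν q - (δ ν (e 1) + δ ν (e 2))|) R C Δ hG (Fin.revPerm : Equiv.Perm (Fin 4)) ?_ ?_
  · intro σ hσ
    -- the gap has a positive limit (`hinge_gap_pos` at the limiting exponents) and the rate diverges
    have hA : ∀ τ : Equiv.Perm (Fin 4), Tendsto (fun ν => ∑ i, |δ ν (e (τ i)) + δ ν (e i) - (δ ν (e 1) + δ ν (e 2))|) atTop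
        (𝓝 (∑ i, |δ0 (e (τ i)) + δ0 (e i) - (δ0 (e 1) + δ0 (e 2))|)) := by
      intro τ
      refine tendsto_finsetSum _ fun i _ => ?_
      exact (((hδ _).add (hδ _)).sub ((hδ _).add (hδ _))).abs
    have hgap := hinge_gap_pos δ0 e hab hbc hcd σ hσ
    have hd : Tendsto (fun ν => (∑ i, |δ ν (e (σ i)) + δ ν (e i) - (δ ν (e 1) + δ ν (e 2))|)
        - ∑ i, |δ ν (e ((Fin.revPerm : Equiv.Perm (Fin 4)) i)) + δ ν (e i) - (δ ν (e 1) + δ ν (e 2))|) atTop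
        (𝓝 ((∑ i, |δ0 (e (σ i)) + δ0 (e i) - (δ0 (e 1) + δ0 (e 2))|)
          - ∑ i, |δ0 (e ((Fin.revPerm : Equiv.Perm (Fin 4)) i)) + δ0 (e i) - (δ0 (e 1) + δ0 (e 2))|)) :=
      (hA σ).sub (hA _)
    have h := gap_tendsto_atTop Δ _ _ (sub_pos.mpr hgap) hΔ hd
    refine h.congr' (Eventually.of_forall fun ν => ?_)
    simp only [mul_sub]
  · simpa [Fin.prod_univ_four, revFour_apply.1, revFour_apply.2.1, revFour_apply.2.2.1, revFour_apply.2.2.2, mul_assoc]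
      using hne


/-- **The same kill in PACKAGE currency** (hypotheses = those of `twoSlope_dictionary` for the hinge member `(b′,c′) = (e 1, e 2)`, plus the vanishing
principal minor on `e`, the limiting order `δ0 a′ < δ0 b′ < δ0 c′ < δ0 d′`, divergence of the gap `s₂ − s₁ → +∞`, and aliveness of the four members
`(e 3,e 0), (e 2,e 1), (e 1,e 2), (e 0,e 3)` in the cluster the flag `B` assigns them to).  Contradiction. [this work] -/
theorem false_of_hinge_strictly_between_of_packages {n : ℕ} (G : ℕ → Matrix (Fin n) (Fin n) ℝ) (e : Fin 4 → Fin n)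
    (hdet : ∀ ν, ((G ν).submatrix e e).det = 0)
    (δ : ℕ → Fin n → ℝ) (δ0 : Fin n → ℝ) (hδ : ∀ l, Tendsto (fun ν => δ ν l) atTop (𝓝 (δ0 l)))
    (hab : δ0 (e 0) < δ0 (e 1)) (hbc : δ0 (e 1) < δ0 (e 2)) (hcd : δ0 (e 2) < δ0 (e 3))
    (s₁ s₂ μ₁ μ₂ : ℕ → ℝ) (hμ₁ : ∀ ν, 0 < μ₁ ν) (hμ₂ : ∀ ν, 0 < μ₂ ν)
    (hL : Tendsto (fun ν => s₂ ν - s₁ ν) atTop atTop)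
    (Γ₁ Γ₂ : Fin n → Fin n → ℝ) (B : Fin n → Fin n → Prop) [DecidableRel B]
    (hB : ∀ p q, B p q → ∀ ν, δ ν p + δ ν q ≤ δ ν (e 1) + δ ν (e 2))
    (hB' : ∀ p q, ¬ B p q → ∀ ν, δ ν (e 1) + δ ν (e 2) ≤ δ ν p + δ ν q)
    (h1 : ∀ p q, B p q →
      Tendsto (fun ν => G ν p q * Real.exp ((δ ν p + δ ν q) * s₁ ν) / μ₁ ν) atTop (𝓝 (Γ₁ p q)))
    (h2 : ∀ p q, ¬ B p q →
      Tendsto (fun ν => G ν p q * Real.exp ((δ ν p + δ ν q) * s₂ ν) / μ₂ ν) atTop (𝓝 (Γ₂ p q)))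
    (hh1 : Tendsto (fun ν => G ν (e 1) (e 2) * Real.exp ((δ ν (e 1) + δ ν (e 2)) * s₁ ν) / μ₁ ν) atTop (𝓝 (Γ₁ (e 1) (e 2))))
    (hh2 : Tendsto (fun ν => G ν (e 1) (e 2) * Real.exp ((δ ν (e 1) + δ ν (e 2)) * s₂ ν) / μ₂ ν) atTop (𝓝 (Γ₂ (e 1) (e 2))))
    (hne1 : Γ₁ (e 1) (e 2) ≠ 0) (hne2 : Γ₂ (e 1) (e 2) ≠ 0)
    (halive : ∀ pq ∈ [((e 3, e 0) : Fin n × Fin n), (e 2, e 1), (e 1, e 2), (e 0, e 3)],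
      (B pq.1 pq.2 ∧ Γ₁ pq.1 pq.2 ≠ 0) ∨ (¬ B pq.1 pq.2 ∧ Γ₂ pq.1 pq.2 ≠ 0)) : False := by
  classical
  have hG := twoSlope_dictionary G δ (e 1) (e 2) s₁ s₂ μ₁ μ₂ hμ₁ hμ₂ Γ₁ Γ₂ B hB hB' h1 h2 hh1 hh2 hne2
  have hκ : Γ₁ (e 1) (e 2) / Γ₂ (e 1) (e 2) ≠ 0 := div_ne_zero hne1 hne2
  have hΔ : Tendsto (fun ν => (s₂ ν - s₁ ν) / 2) atTop atTop := hL.atTop_div_const (by norm_num)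
  refine false_of_hinge_strictly_between G e hdet δ δ0 hδ hab hbc hcd _ _ _ (fun ν => (s₂ ν - s₁ ν) / 2) hΔ hG ?_
  have hz : ∀ p q, (B p q ∧ Γ₁ p q ≠ 0) ∨ (¬ B p q ∧ Γ₂ p q ≠ 0) →
      (if B p q then Γ₁ p q else Γ₁ (e 1) (e 2) / Γ₂ (e 1) (e 2) * Γ₂ p q) ≠ 0 :=
    fun p q h => (glued_ne_zero_iff Γ₁ Γ₂ B _ hκ p q).mpr h
  have h30 := hz (e 3) (e 0) (halive (e 3, e 0) (by simp))
  have h21 := hz (e 2) (e 1) (halive (e 2, e 1) (by simp))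
  have h12 := hz (e 1) (e 2) (halive (e 1, e 2) (by simp))
  have h03 := hz (e 0) (e 3) (halive (e 0, e 3) (by simp))
  exact mul_ne_zero (mul_ne_zero (mul_ne_zero h30 h21) h12) h03

end Summit.ValiantsHypothesis.ValiantsHypothesis.Theorems.LacunarySymmetroidMatrixDescartes.WallBubbling
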